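import Literature.NumberTheory.Sieve.FriedlanderIwaniecPrimes
import Literature.NumberTheory.Sieve.SmoothMajorantLocal
import HarnessLib

/-!
# Friedlander–Iwaniec, *The polynomial `X² + Y⁴` captures its primes*: the squarefree-supported sequence

Family `parity`, statement parity.S17. Source: J. Friedlander, H. Iwaniec, Ann. of Math. (2) 148
(1998), 945–1040 [FriedlanderIwaniecAnnals1998], §§2–4; companion: *Asymptotic sieve for primes*,
ibid. 1041–1065 [FriedlanderIwaniecASP1998], Theorem 1 (sequences supported on squarefree
integers) — see G. Harman, *Prime-Detecting Sieves* (2007), Theorems 12.3–12.5 [Harman2007].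

## Purpose

`Literature.NumberTheory.Sieve.FriedlanderIwaniecPrimes` derives parity.S17 (FI Theorem 1) from
FI's Proposition 2.1 (`FriedlanderIwaniec1998_prop21`, the asymptotic sieve for primes, vendored AS
PRINTED) applied to the sequence `a_n = #{(a, c) ∈ ℤ² : a² + c⁴ = n}` (`fiSieveSeq`), at the price of
the §3 hypotheses (2.2), (2.7), (2.8) as named facts. Hypothesis (2.8) in its printed form,
"`A_d(x) ≪ d⁻¹ τ(d)⁸ A(x)` uniformly in `d ≤ x^{1/3}`", is FALSE for `a_n`
(`FriedlanderIwaniec1998_hyp28_false` in `FriedlanderIwaniecPrimesHyp28`: the moduli `d = p⁴`), so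
that route is vacuous. The present file and its sequel `FriedlanderIwaniecPrimesSquarefreeProofs`
repair the route WITHOUT touching the printed statements: Proposition 2.1 is applied instead to the
squarefree-supported sequence

  `a'_n = μ(n)² a_n`  (`fiSieveSeqSq`),

for which (2.8) holds as printed (`A'_d = 0` unless `d` is squarefree, and for squarefree `d` the
congruence `a² + c⁴ ≡ 0 (mod d)` has at most `τ(d)` roots `a` for each `c`), whose prime terms are
those of `a_n` (`a'_p = a_p`: primes are squarefree), and whose sieve data are

* density `g'` (`fiDensitySq`): `g'(p) = (g(p) - g(p²)) / (1 - g(p²))`, `g'(p^k) = 0` for `k ≥ 2`,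
  where `g` is FI's density (3.16) (`fiDensity`); indeed, by inclusion–exclusion over the square
  divisors, `A'_d(x) = ∑_ℓ μ(ℓ) A_{[d, ℓ²]}(x) ≈ A(x) ∏_{p ∣ d} (g(p) - g(p²)) ∏_{p ∤ d} (1 - g(p²))`;
* counting function `A'(x) = ∑_{n ≤ x, n squarefree} a_n` (`fiCountSq`), asymptotically
  `A'(x) ∼ P_∞ A(x)` with `P_∞ = ∏_p (1 - g(p²)) > 0` (`fiSqConst`, the limit of the partial
  products `fiSqProd y = ∏_{p ≤ y} (1 - g(p²))`);
* sieve constant `H' = ∏_p (1 - g'(p))(1 - 1/p)⁻¹ = H / P_∞ = (4/π) / P_∞`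
  (`hasDensityConstant_fiSieveSeqSq`), since `1 - g'(p) = (1 - g(p)) / (1 - g(p²))`; thus
  `H' A'(x) ∼ H A(x)` and Proposition 2.1 for `a'` yields (4.7) for `a`.

This is the classical relation between the two forms of the asymptotic sieve for primes
([FriedlanderIwaniecASP1998] Theorem 1, squarefree support, versus FI Proposition 2.1 =
[Harman2007] Theorem 12.4/12.5, arbitrary support with the extra hypotheses (2.2), (2.4), (2.6) and
cubefree level (2.9)), run in the easy direction. This file contains the DEFINITIONS and their
algebraic API; the verification of (2.1)–(2.15) for `a'` from FI's Propositions 3.5 and 4.1 and the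
deduction of `FriedlanderIwaniec1998_primeSum_asymp` are in the sequel.

## Contents

* `fiDensitySq` (`g'`), `isMultiplicative_fiDensitySq`, `fiDensitySq_prime`,
  `fiDensitySq_prime_pow_eq_zero` (`k ≥ 2`), `fiDensitySq_eq_zero_of_not_squarefree`,
  `one_sub_fiDensity_sq_pos`, `one_sub_fiDensitySq_prime`, `fiDensitySq_prime_nonneg`,
  `fiDensitySq_prime_le` (`g'(p) ≤ g(p)`), `fiDensitySq_prime_lt_one`,
  `fiDensity_prime_sub_fiDensitySq_le` (`g(p) - g'(p) ≤ g(p²)`), `fiDensitySq_hyp24`,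
  `fiDensitySq_hyp2526` (the clauses (2.4)–(2.6) of `FI1998SieveHypotheses` for `g'`),
  `fiDensitySq_eq_prod_of_squarefree`, `fiDensitySq_squarefree_nonneg_le` (`0 ≤ g'(d) ≤ g(d)` for
  squarefree `d`), `fiDensitySq_nonneg`;
* `fiCountSq` (`A'(x)`), `fiSieveSeqSq` (`a'`), `fiSieveSeqSq_a`, `fiSieveSeqSq_a_prime`,
  `fiSieveSeqSq_a_le`, `fiSieveSeqSq_size_eq`, `fiSieveSeqSq_congrSum_le`, `fiCountSq_le_fiCount`,
  `fiCountSq_nonneg`, `fiSieveSeqSq_congrSum_eq_zero`, `fiSieveSeqSq_remainder_eq_zero`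
  (non-squarefree moduli), `fiSieveSeqSq_primeSum` (`∑_{p ≤ x} a'_p log p = S(x)`);
* `fiSqProd`, `fiSqConst` (`P(y)`, `P_∞`): `fiSqProd_factor_bounds`, `fiSqProd_pos_le_one`,
  `fiSqProd_anti`, `sum_primesLE_fiDensity_sq_le`, `exp_neg_six_le_fiSqProd`, `tendsto_fiSqProd`,
  `exp_neg_six_le_fiSqConst`, `fiSqConst_pos`, `fiSqConst_le_fiSqProd`, `fiSqConst_le_one`,
  `fiSqProd_sub_fiSqProd_le`, `fiSqProd_sub_fiSqConst_le` (`0 ≤ P(y) - P_∞ ≤ 3/y`);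
* `fiSieveSeqSq_eulerFactor`, `fiSieveSeqSq_prod_eulerFactor`, `hasDensityConstant_fiSieveSeqSq`
  (`H' = H/P_∞`), `hasDensityConstant_fiSieveSeqSq_of_densityConstant` (`H' = (4/π)/P_∞` from
  (4.8) for `a`).

## References

* J. Friedlander, H. Iwaniec, *The polynomial `X² + Y⁴` captures its primes*, Ann. of Math. (2)
  148 (1998), 945–1040: §2 (2.1)–(2.17), Proposition 2.1; §3 (3.16)–(3.19) and the paragraph after
  Proposition 3.5. [cite: FriedlanderIwaniecAnnals1998, §§2-3]
* J. Friedlander, H. Iwaniec, *Asymptotic sieve for primes*, Ann. of Math. (2) 148 (1998),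
  1041–1065, Theorem 1 (hypothesis (1.16): support on squarefree integers).
  [cite: FriedlanderIwaniecASP1998, Theorem 1]
* G. Harman, *Prime-Detecting Sieves*, LMS Monographs 33, Princeton 2007, §12.9, Theorems
  12.3–12.5, pp. 247–249. [cite: Harman2007, §12.9]

## Mathlib / tree

Reused: `Literature.NumberTheory.Sieve.SieveSequence` (`congrSum`, `remainder`, `HasDensityConstant`), `Literature.NumberTheory.Sieve.fiDensity`,
`fiRepCount`, `fiCount`, `fiSieveSeq`, `fiDensity_hyp24`, `fiDensity_hyp2526`,
`FriedlanderIwaniec1998_densityConstant` (all `FriedlanderIwaniecPrimes`),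
`Literature.NumberTheory.Sieve.CFZ.one_sub_sum_le_prod_one_sub` (Weierstrass' inequality, `SmoothMajorantLocal`); Mathlib
`Squarefree`, `Nat.factorization`, `tendsto_atTop_ciInf`, `sum_Ioc_inv_sq_le_sub`. Nothing is
redefined.
-/

noncomputable section

open Filter Finset Real
open scoped Topology ArithmeticFunction.sigma

namespace Literature.NumberTheory.Sieve

/-! ### The density `g'` of the squarefree-supported sequence -/

/-- The values of `g'` on prime powers: `g'(1) = 1`, `g'(p) = (g(p) - g(p²)) / (1 - g(p²))`,
`g'(p^k) = 0` for `k ≥ 2` (the squarefree-supported sequence has no mass on multiples of `p²`).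
Not printed in FI: it is the density forced on `a'_n = μ(n)² a_n` by FI's `g` of (3.16) through
`A'_d = ∑_ℓ μ(ℓ) A_{[d,ℓ²]}` (module docstring). [folklore] -/
def fiDensitySqPrimePow (p k : ℕ) : ℝ :=
  if k = 0 then 1
  else if k = 1 then (fiDensity p - fiDensity (p ^ 2)) / (1 - fiDensity (p ^ 2))
  else 0

/-- The density `g'` of the squarefree-supported sequence `a'_n = μ(n)² a_n`, extended
multiplicatively (`g'(0) = 0`): for squarefree `d`,
`g'(d) = ∏_{p ∣ d} (g(p) - g(p²)) / (1 - g(p²))`, and `g'(d) = 0` otherwise (derived from FI's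
`g`, (3.16); not printed there). [folklore] -/
def fiDensitySq : ArithmeticFunction ℝ :=
  ⟨fun d => if d = 0 then 0 else d.factorization.prod fun p k => fiDensitySqPrimePow p k,
    if_pos rfl⟩

/-- Unfolding `fiDensitySq` at `d ≠ 0`. [folklore] -/
theorem fiDensitySq_apply {d : ℕ} (hd : d ≠ 0) :
    fiDensitySq d = d.factorization.prod fun p k => fiDensitySqPrimePow p k := by
  simp [fiDensitySq, hd]

/-- `g'` is multiplicative. [folklore] -/
theorem isMultiplicative_fiDensitySq : fiDensitySq.IsMultiplicative := by
  refine ArithmeticFunction.IsMultiplicative.iff_ne_zero.mpr ⟨by simp [fiDensitySq], ?_⟩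
  intro m n hm hn hmn
  rw [fiDensitySq_apply hm, fiDensitySq_apply hn, fiDensitySq_apply (mul_ne_zero hm hn),
    Nat.factorization_mul_of_coprime hmn, Finsupp.prod_add_index_of_disjoint]
  simpa [Nat.support_factorization] using hmn.disjoint_primeFactors

/-- `g'(p^k)` on a prime power. [folklore] -/
theorem fiDensitySq_prime_pow {p : ℕ} (hp : p.Prime) (k : ℕ) :
    fiDensitySq (p ^ k) = fiDensitySqPrimePow p k := by
  rw [fiDensitySq_apply (pow_ne_zero k hp.ne_zero), hp.factorization_pow,
    Finsupp.prod_single_index]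
  simp [fiDensitySqPrimePow]

/-- `g'(p) = (g(p) - g(p²)) / (1 - g(p²))`. [folklore] -/
theorem fiDensitySq_prime {p : ℕ} (hp : p.Prime) :
    fiDensitySq p = (fiDensity p - fiDensity (p ^ 2)) / (1 - fiDensity (p ^ 2)) := by
  simpa [fiDensitySqPrimePow] using fiDensitySq_prime_pow hp 1

/-- `g'(p^k) = 0` for `k ≥ 2`. [folklore] -/
theorem fiDensitySq_prime_pow_eq_zero {p : ℕ} (hp : p.Prime) {k : ℕ} (hk : 2 ≤ k) :
    fiDensitySq (p ^ k) = 0 := by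
  rw [fiDensitySq_prime_pow hp k]
  simp [fiDensitySqPrimePow, show k ≠ 0 by omega, show k ≠ 1 by omega]

/-- `g'(d) = 0` unless `d` is squarefree. [folklore] -/
theorem fiDensitySq_eq_zero_of_not_squarefree {d : ℕ} (hd : ¬Squarefree d) : fiDensitySq d = 0 := by
  rcases eq_or_ne d 0 with rfl | hd0
  · simp [fiDensitySq]
  obtain ⟨p, hp, hpd⟩ : ∃ p, Nat.Prime p ∧ p * p ∣ d := by
    by_contra h
    exact hd (Nat.squarefree_iff_prime_squarefree.mpr fun p hp hpd => h ⟨p, hp, hpd⟩)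
  -- split off the full power of `p`
  have hp' : p.Prime := hp
  set k := d.factorization p with hk
  have hk2 : 2 ≤ k := by
    rw [hk, ← hp'.pow_dvd_iff_le_factorization hd0, pow_two]; exact hpd
  obtain ⟨e, he, hpe⟩ : ∃ e, d = p ^ k * e ∧ ¬p ∣ e :=
    ⟨d / p ^ k, (Nat.mul_div_cancel' (Nat.ordProj_dvd d p)).symm, Nat.not_dvd_ordCompl hp' hd0⟩
  have hcop : (p ^ k).Coprime e := (Nat.coprime_pow_left_iff (by omega) _ _).mpr
    ((Nat.Prime.coprime_iff_not_dvd hp').mpr hpe)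
  rw [he, isMultiplicative_fiDensitySq.map_mul_of_coprime hcop, fiDensitySq_prime_pow_eq_zero hp' hk2,
    zero_mul]

/-- `1 - g(p²) > 0` (indeed `g(p²) ≤ g(p) < 1`, (2.4) for `g`, `fiDensity_hyp24`). [folklore] -/
theorem one_sub_fiDensity_sq_pos {p : ℕ} (hp : p.Prime) : 0 < 1 - fiDensity (p ^ 2) := by
  have h := fiDensity_hyp24 hp
  linarith [h.2.1, h.2.2]

/-- `1 - g'(p) = (1 - g(p)) / (1 - g(p²))`: the Euler factors (2.17) of `H'` and `H` differ by
`(1 - g(p²))⁻¹`. [folklore] -/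
theorem one_sub_fiDensitySq_prime {p : ℕ} (hp : p.Prime) :
    1 - fiDensitySq p = (1 - fiDensity p) / (1 - fiDensity (p ^ 2)) := by
  rw [fiDensitySq_prime hp]
  have h := (one_sub_fiDensity_sq_pos hp).ne'
  field_simp
  ring

/-- `g'(p) ≥ 0` (since `g(p²) ≤ g(p)`, (2.4) for `g`). [folklore] -/
theorem fiDensitySq_prime_nonneg {p : ℕ} (hp : p.Prime) : 0 ≤ fiDensitySq p := by
  rw [fiDensitySq_prime hp]
  have h := fiDensity_hyp24 hp
  exact div_nonneg (by linarith [h.2.1]) (one_sub_fiDensity_sq_pos hp).le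

/-- `g'(p) ≤ g(p)`. [folklore] -/
theorem fiDensitySq_prime_le {p : ℕ} (hp : p.Prime) : fiDensitySq p ≤ fiDensity p := by
  rw [fiDensitySq_prime hp, div_le_iff₀ (one_sub_fiDensity_sq_pos hp)]
  have h := fiDensity_hyp24 hp
  nlinarith [h.1, h.2.1, h.2.2]

/-- `g'(p) < 1`. [folklore] -/
theorem fiDensitySq_prime_lt_one {p : ℕ} (hp : p.Prime) : fiDensitySq p < 1 :=
  (fiDensitySq_prime_le hp).trans_lt (fiDensity_hyp24 hp).2.2

/-- `0 ≤ g(p) - g'(p) ≤ g(p²)`: `g'` is a perturbation of `g` of size `O(p⁻²)` at the primes.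
[folklore] -/
theorem fiDensity_prime_sub_fiDensitySq_le {p : ℕ} (hp : p.Prime) :
    fiDensity p - fiDensitySq p ≤ fiDensity (p ^ 2) := by
  have h := fiDensity_hyp24 hp
  have h1 := one_sub_fiDensity_sq_pos hp
  have : fiDensity p - fiDensitySq p = fiDensity (p ^ 2) * (1 - fiDensity p) / (1 - fiDensity (p ^ 2)) := by
    rw [fiDensitySq_prime hp]
    field_simp
    ring
  rw [this, div_le_iff₀ h1]
  nlinarith [h.1, h.2.1, h.2.2]

/-- Hypothesis (2.4) of FI Proposition 2.1 for `g'`: `0 ≤ g'(p²) ≤ g'(p) < 1`.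
[cite: FriedlanderIwaniecAnnals1998, (2.4)] -/
theorem fiDensitySq_hyp24 {p : ℕ} (hp : p.Prime) :
    0 ≤ fiDensitySq (p ^ 2) ∧ fiDensitySq (p ^ 2) ≤ fiDensitySq p ∧ fiDensitySq p < 1 := by
  rw [fiDensitySq_prime_pow_eq_zero hp le_rfl]
  exact ⟨le_rfl, fiDensitySq_prime_nonneg hp, fiDensitySq_prime_lt_one hp⟩

/-- Hypotheses (2.5)–(2.6) of FI Proposition 2.1 for `g'`: `g'(p) ≤ 2/p`, `g'(p²) = 0 ≤ 3/p²`.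
[cite: FriedlanderIwaniecAnnals1998, (2.5)-(2.6)] -/
theorem fiDensitySq_hyp2526 {p : ℕ} (hp : p.Prime) :
    fiDensitySq p ≤ 2 / p ∧ fiDensitySq (p ^ 2) ≤ 3 / (p : ℝ) ^ 2 := by
  refine ⟨(fiDensitySq_prime_le hp).trans (fiDensity_hyp2526 hp).1, ?_⟩
  rw [fiDensitySq_prime_pow_eq_zero hp le_rfl]
  positivity

/-- For squarefree `d`, `g'(d) = ∏_{p ∣ d} g'(p)` and `g(d) = ∏_{p ∣ d} g(p)`. [folklore] -/
theorem fiDensitySq_eq_prod_of_squarefree {d : ℕ} (hd : Squarefree d) :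
    fiDensitySq d = ∏ p ∈ d.primeFactors, fiDensitySq p :=
  (isMultiplicative_fiDensitySq.prod_primeFactors hd).symm

/-- For squarefree `d`, `0 ≤ g'(d) ≤ g(d)`. [folklore] -/
theorem fiDensitySq_squarefree_nonneg_le {d : ℕ} (hd : Squarefree d) :
    0 ≤ fiDensitySq d ∧ fiDensitySq d ≤ fiDensity d := by
  rw [← isMultiplicative_fiDensitySq.prod_primeFactors hd,
    ← isMultiplicative_fiDensity.prod_primeFactors hd]
  refine ⟨Finset.prod_nonneg fun p hp => fiDensitySq_prime_nonneg (Nat.prime_of_mem_primeFactors hp),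
    Finset.prod_le_prod (fun p hp => fiDensitySq_prime_nonneg (Nat.prime_of_mem_primeFactors hp))
      fun p hp => fiDensitySq_prime_le (Nat.prime_of_mem_primeFactors hp)⟩

/-- `g'(d) ≥ 0` for every `d`. [folklore] -/
theorem fiDensitySq_nonneg (d : ℕ) : 0 ≤ fiDensitySq d := by
  by_cases hd : Squarefree d
  · exact (fiDensitySq_squarefree_nonneg_le hd).1
  · rw [fiDensitySq_eq_zero_of_not_squarefree hd]

/-! ### The squarefree-supported sequence `a'_n = μ(n)² a_n` -/

/-- `A'(x) = ∑_{n ≤ x, n squarefree} a_n`, the counting function of the squarefree-supported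
sequence (the `A(x)` of [FriedlanderIwaniecASP1998] (1.3) for a sequence satisfying (1.16) there).
[folklore] -/
def fiCountSq (x : ℝ) : ℝ := ∑ n ∈ (Icc 1 ⌊x⌋₊).filter Squarefree, (fiRepCount n : ℝ)

/-- The squarefree-supported sequence `a'_n = μ(n)² a_n` as a sifted sequence: size `A'(x)`
itself (as FI (2.3) demands), density `g'`; it is supported on squarefree integers as in
[FriedlanderIwaniecASP1998] Theorem 1, (1.16) (= [Harman2007] Theorem 12.3). [folklore] -/
def fiSieveSeqSq : SieveSequence where
  a n := if Squarefree n then (fiRepCount n : ℝ) else 0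
  a_nonneg n := by split_ifs <;> positivity
  size := fiCountSq
  density := fiDensitySq
  density_mult := isMultiplicative_fiDensitySq

/-- `a'_n = a_n` for squarefree `n` and `0` otherwise. [folklore] -/
theorem fiSieveSeqSq_a (n : ℕ) :
    fiSieveSeqSq.a n = if Squarefree n then (fiRepCount n : ℝ) else 0 := rfl

/-- `a'_p = a_p` at primes. [folklore] -/
theorem fiSieveSeqSq_a_prime {p : ℕ} (hp : p.Prime) : fiSieveSeqSq.a p = fiRepCount p := by
  rw [fiSieveSeqSq_a, if_pos hp.squarefree]

/-- `0 ≤ a'_n ≤ a_n`. [folklore] -/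
theorem fiSieveSeqSq_a_le (n : ℕ) : fiSieveSeqSq.a n ≤ fiSieveSeq.a n := by
  rw [fiSieveSeqSq_a]
  change _ ≤ (fiRepCount n : ℝ)
  split_ifs <;> simp

/-- `fiSieveSeqSq.size = A'(x) = A'_1(x)` (FI (2.3): the size is the counting function itself;
this is the clause `size_eq` of `FI1998SieveHypotheses`). [folklore] -/
theorem fiSieveSeqSq_size_eq (x : ℝ) : fiSieveSeqSq.size x = fiSieveSeqSq.congrSum 1 x := by
  change fiCountSq x = _
  simp only [SieveSequence.congrSum, fiCountSq, Finset.filter_true_of_mem fun n _ => one_dvd n,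
    fiSieveSeqSq_a, Finset.sum_filter]
  refine Finset.sum_congr ?_ fun _ _ => rfl
  ext n; simp [Nat.one_le_iff_ne_zero, Nat.pos_iff_ne_zero]

/-- `A'_d(x) ≤ A_d(x)`. [folklore] -/
theorem fiSieveSeqSq_congrSum_le (d : ℕ) (x : ℝ) :
    fiSieveSeqSq.congrSum d x ≤ fiSieveSeq.congrSum d x :=
  Finset.sum_le_sum fun n _ => fiSieveSeqSq_a_le n

/-- `A'(x) ≤ A(x)`. [folklore] -/
theorem fiCountSq_le_fiCount (x : ℝ) : fiCountSq x ≤ fiCount x := by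
  have h := fiSieveSeqSq_congrSum_le 1 x
  rwa [← fiSieveSeqSq_size_eq, ← fiSieveSeq_size_eq] at h

/-- `0 ≤ A'(x)`. [folklore] -/
theorem fiCountSq_nonneg (x : ℝ) : 0 ≤ fiCountSq x :=
  Finset.sum_nonneg fun _ _ => Nat.cast_nonneg _

/-- `A'_d(x) = 0` unless `d` is squarefree (a multiple of a non-squarefree number is not
squarefree). [folklore] -/
theorem fiSieveSeqSq_congrSum_eq_zero {d : ℕ} (hd : ¬Squarefree d) (x : ℝ) :
    fiSieveSeqSq.congrSum d x = 0 := by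
  refine Finset.sum_eq_zero fun n hn => ?_
  rw [Finset.mem_filter] at hn
  rw [fiSieveSeqSq_a, if_neg fun h => hd (h.squarefree_of_dvd hn.2)]

/-- `r'_d(x) = 0` unless `d` is squarefree. [folklore] -/
theorem fiSieveSeqSq_remainder_eq_zero {d : ℕ} (hd : ¬Squarefree d) (x : ℝ) :
    fiSieveSeqSq.remainder d x = 0 := by
  rw [SieveSequence.remainder, fiSieveSeqSq_congrSum_eq_zero hd]
  change 0 - fiDensitySq d * _ = 0
  rw [fiDensitySq_eq_zero_of_not_squarefree hd]; ring

/-- The prime sums of `a'` and `a` agree: `∑_{p ≤ x} a'_p log p = S(x)`. [folklore] -/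
theorem fiSieveSeqSq_primeSum (x : ℝ) :
    ∑ p ∈ Nat.primesLE ⌊x⌋₊, fiSieveSeqSq.a p * Real.log p = fiPrimeSum x :=
  Finset.sum_congr rfl fun p hp => by rw [fiSieveSeqSq_a_prime (Nat.prime_of_mem_primesLE hp)]

/-! ### The Euler product `P(y) = ∏_{p ≤ y} (1 - g(p²))` and its limit `P_∞` -/

/-- `P(y) = ∏_{p ≤ y} (1 - g(p²))`, the density of the integers free of square factors `p²`,
`p ≤ y`, relative to `a_n`. [folklore] -/
def fiSqProd (y : ℕ) : ℝ := ∏ p ∈ Nat.primesLE y, (1 - fiDensity (p ^ 2))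

/-- `P_∞ = ∏_p (1 - g(p²)) = inf_y P(y)` (the partial products decrease). [folklore] -/
def fiSqConst : ℝ := ⨅ y : ℕ, fiSqProd y

/-- Each factor satisfies `exp(-2 g(p²)) ≤ 1 - g(p²) ≤ 1` (as `0 ≤ g(p²) ≤ 1/2`). [folklore] -/
theorem fiSqProd_factor_bounds {p : ℕ} (hp : p.Prime) :
    Real.exp (-2 * fiDensity (p ^ 2)) ≤ 1 - fiDensity (p ^ 2) ∧ 1 - fiDensity (p ^ 2) ≤ 1 ∧
      0 ≤ fiDensity (p ^ 2) ∧ fiDensity (p ^ 2) ≤ 3 / (p : ℝ) ^ 2 := by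
  have h24 := fiDensity_hyp24 hp
  have h26 := (fiDensity_hyp2526 hp).2
  have hhalf : fiDensity (p ^ 2) ≤ 1 / 2 := by
    by_cases hp2 : p = 2
    · subst hp2; rw [show (2 : ℕ) ^ 2 = 4 by norm_num, fiDensity_four]; norm_num
    · have hp3 : (3 : ℝ) ≤ p := by
        have : 3 ≤ p := by
          rcases hp.eq_two_or_odd' with h | h
          · exact absurd h hp2
          · have := hp.two_le; omega
        exact_mod_cast this
      calc fiDensity (p ^ 2) ≤ 3 / (p : ℝ) ^ 2 := h26
        _ ≤ 3 / (3 : ℝ) ^ 2 := by gcongr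
        _ ≤ 1 / 2 := by norm_num
  refine ⟨?_, by linarith [h24.1], h24.1, h26⟩
  -- `exp(-2u) ≤ 1 - u` for `0 ≤ u ≤ 1/2`: from `exp(y) ≤ 1/(1 - y)` for `y < 1` with `y = 2u`... use
  -- the bound `Real.exp_le_one_sub_inv`? We argue via `add_one_le_exp`: `1 + 2u ≤ exp(2u)`, and
  -- `(1 - u)(1 + 2u) = 1 + u - 2u² ≥ 1` for `0 ≤ u ≤ 1/2`.
  set u := fiDensity (p ^ 2) with hu
  have h1 : 1 + 2 * u ≤ Real.exp (2 * u) := by linarith [Real.add_one_le_exp (2 * u)]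
  have h2 : 1 ≤ (1 - u) * (1 + 2 * u) := by nlinarith [h24.1, hhalf]
  have h3 : 0 < Real.exp (2 * u) := Real.exp_pos _
  rw [show -2 * u = -(2 * u) by ring, Real.exp_neg, inv_le_iff_one_le_mul₀ h3]
  calc 1 ≤ (1 - u) * (1 + 2 * u) := h2
    _ ≤ (1 - u) * Real.exp (2 * u) := by
        exact mul_le_mul_of_nonneg_left h1 (by linarith)

/-- `0 < P(y) ≤ 1`. [folklore] -/
theorem fiSqProd_pos_le_one (y : ℕ) : 0 < fiSqProd y ∧ fiSqProd y ≤ 1 := by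
  refine ⟨Finset.prod_pos fun p hp => one_sub_fiDensity_sq_pos (Nat.prime_of_mem_primesLE hp), ?_⟩
  refine Finset.prod_le_one (fun p hp => (one_sub_fiDensity_sq_pos (Nat.prime_of_mem_primesLE hp)).le)
    fun p hp => (fiSqProd_factor_bounds (Nat.prime_of_mem_primesLE hp)).2.1

/-- `P` is non-increasing. [folklore] -/
theorem fiSqProd_anti : Antitone fiSqProd := by
  refine antitone_nat_of_succ_le fun y => ?_
  unfold fiSqProd
  have hsub : Nat.primesLE y ⊆ Nat.primesLE (y + 1) := fun p hp => by
    rw [Nat.mem_primesLE] at hp ⊢; exact ⟨hp.1.trans (Nat.le_succ y), hp.2⟩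
  exact Finset.prod_le_prod_of_subset_of_le_one hsub
    (fun p hp => (one_sub_fiDensity_sq_pos (Nat.prime_of_mem_primesLE hp)).le)
    fun p hp _ => (fiSqProd_factor_bounds (Nat.prime_of_mem_primesLE hp)).2.1

/-- `∑_{p ≤ y} g(p²) ≤ 3` (from `g(p²) ≤ 3/p²` and Mathlib's `sum_Ioc_inv_sq_le_sub`:
`∑_{1 < n ≤ y} n⁻² ≤ 1`). [folklore] -/
theorem sum_primesLE_fiDensity_sq_le (y : ℕ) :
    ∑ p ∈ Nat.primesLE y, fiDensity (p ^ 2) ≤ 3 := by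
  rcases Nat.eq_zero_or_pos y with rfl | hy
  · simp
  have hsub : Nat.primesLE y ⊆ Finset.Ioc 1 y := fun p hp => by
    rw [Nat.mem_primesLE] at hp; rw [Finset.mem_Ioc]; exact ⟨hp.2.one_lt, hp.1⟩
  calc ∑ p ∈ Nat.primesLE y, fiDensity (p ^ 2) ≤ ∑ p ∈ Nat.primesLE y, 3 / (p : ℝ) ^ 2 :=
        Finset.sum_le_sum fun p hp => (fiSqProd_factor_bounds (Nat.prime_of_mem_primesLE hp)).2.2.2
    _ ≤ ∑ n ∈ Finset.Ioc 1 y, 3 / (n : ℝ) ^ 2 :=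
        Finset.sum_le_sum_of_subset_of_nonneg hsub fun n _ _ => by positivity
    _ = 3 * ∑ n ∈ Finset.Ioc 1 y, ((n : ℝ) ^ 2)⁻¹ := by
        rw [Finset.mul_sum]; exact Finset.sum_congr rfl fun n _ => by rw [div_eq_mul_inv]
    _ ≤ 3 * ((1 : ℕ) : ℝ)⁻¹ := by
        have h := sum_Ioc_inv_sq_le_sub (α := ℝ) one_ne_zero hy
        have : (0 : ℝ) ≤ (y : ℝ)⁻¹ := by positivity
        nlinarith
    _ = 3 := by simp

/-- `exp(-6) ≤ P(y)`. [folklore] -/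
theorem exp_neg_six_le_fiSqProd (y : ℕ) : Real.exp (-6) ≤ fiSqProd y := by
  calc Real.exp (-6) ≤ Real.exp (∑ p ∈ Nat.primesLE y, -2 * fiDensity (p ^ 2)) := by
        refine Real.exp_le_exp.mpr ?_
        rw [← Finset.mul_sum]
        linarith [sum_primesLE_fiDensity_sq_le y]
    _ = ∏ p ∈ Nat.primesLE y, Real.exp (-2 * fiDensity (p ^ 2)) := Real.exp_sum _ _
    _ ≤ fiSqProd y := Finset.prod_le_prod (fun _ _ => (Real.exp_pos _).le)
        fun p hp => (fiSqProd_factor_bounds (Nat.prime_of_mem_primesLE hp)).1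

/-- `P(y) → P_∞` (a non-increasing sequence bounded below). [folklore] -/
theorem tendsto_fiSqProd : Tendsto fiSqProd atTop (𝓝 fiSqConst) :=
  tendsto_atTop_ciInf fiSqProd_anti ⟨0, fun _ ⟨y, hy⟩ => hy ▸ (fiSqProd_pos_le_one y).1.le⟩

/-- `P_∞ ≥ exp(-6) > 0`. [folklore] -/
theorem exp_neg_six_le_fiSqConst : Real.exp (-6) ≤ fiSqConst :=
  le_ciInf exp_neg_six_le_fiSqProd

/-- `P_∞ > 0`. [folklore] -/
theorem fiSqConst_pos : 0 < fiSqConst := (Real.exp_pos _).trans_le exp_neg_six_le_fiSqConst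

/-- `P_∞ ≤ P(y)`. [folklore] -/
theorem fiSqConst_le_fiSqProd (y : ℕ) : fiSqConst ≤ fiSqProd y :=
  ciInf_le ⟨0, fun _ ⟨y, hy⟩ => hy ▸ (fiSqProd_pos_le_one y).1.le⟩ y

/-- `P_∞ ≤ 1`. [folklore] -/
theorem fiSqConst_le_one : fiSqConst ≤ 1 := (fiSqConst_le_fiSqProd 0).trans (fiSqProd_pos_le_one 0).2

/-- Tail of the product: `P(y) - P(z) ≤ ∑_{y < p ≤ z} g(p²) ≤ 3/y` for `1 ≤ y ≤ z` (Weierstrass'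
inequality, the tree's `Literature.NumberTheory.Sieve.CFZ.one_sub_sum_le_prod_one_sub`, and Mathlib's `sum_Ioc_inv_sq_le_sub`).
[folklore] -/
theorem fiSqProd_sub_fiSqProd_le {y z : ℕ} (hy : 1 ≤ y) (hyz : y ≤ z) :
    fiSqProd y - fiSqProd z ≤ 3 / y := by
  -- `P(z) = P(y) ∏_{y < p ≤ z} (1 - g(p²)) ≥ P(y) (1 - ∑_{y < p ≤ z} g(p²))`
  have hsplit : fiSqProd z = fiSqProd y * ∏ p ∈ (Nat.primesLE z).filter (fun p => y < p),
      (1 - fiDensity (p ^ 2)) := by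
    unfold fiSqProd
    rw [← Finset.prod_union]
    · congr 1
      ext p
      simp only [Finset.mem_union, Finset.mem_filter, Nat.mem_primesLE]
      constructor
      · rintro ⟨hpz, hp⟩
        by_cases h : p ≤ y
        · exact Or.inl ⟨h, hp⟩
        · exact Or.inr ⟨⟨hpz, hp⟩, not_le.mp h⟩
      · rintro (⟨hpy, hp⟩ | ⟨⟨hpz, hp⟩, -⟩)
        · exact ⟨hpy.trans hyz, hp⟩
        · exact ⟨hpz, hp⟩
    · rw [Finset.disjoint_left]
      intro p hp hp'
      rw [Nat.mem_primesLE] at hp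
      rw [Finset.mem_filter] at hp'
      exact absurd hp.1 (not_le.mpr hp'.2)
  -- Weierstrass: `∏ (1 - u_i) ≥ 1 - ∑ u_i` for `u_i ∈ [0, 1]`
  have hW : 1 - ∑ p ∈ (Nat.primesLE z).filter (fun p => y < p), fiDensity (p ^ 2) ≤
      ∏ p ∈ (Nat.primesLE z).filter (fun p => y < p), (1 - fiDensity (p ^ 2)) := by
    refine Literature.NumberTheory.Sieve.CFZ.one_sub_sum_le_prod_one_sub _ (fun p hp => ?_) (fun p hp => ?_)
    · exact (fiSqProd_factor_bounds (Nat.prime_of_mem_primesLE (Finset.mem_filter.mp hp).1)).2.2.1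
    · have hp' := Nat.prime_of_mem_primesLE (Finset.mem_filter.mp hp).1
      linarith [(fiSqProd_factor_bounds hp').2.1, (one_sub_fiDensity_sq_pos hp').le]
  -- `∑_{y < p ≤ z} g(p²) ≤ ∑_{y < n ≤ z} 3/n² ≤ 3/y`
  have htail : ∑ p ∈ (Nat.primesLE z).filter (fun p => y < p), fiDensity (p ^ 2) ≤ 3 / y := by
    have hsub : (Nat.primesLE z).filter (fun p => y < p) ⊆ Finset.Ioc y z := fun p hp => by
      rw [Finset.mem_filter, Nat.mem_primesLE] at hp; rw [Finset.mem_Ioc]; exact ⟨hp.2, hp.1.1⟩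
    calc ∑ p ∈ (Nat.primesLE z).filter (fun p => y < p), fiDensity (p ^ 2)
        ≤ ∑ p ∈ (Nat.primesLE z).filter (fun p => y < p), 3 / (p : ℝ) ^ 2 :=
          Finset.sum_le_sum fun p hp =>
            (fiSqProd_factor_bounds (Nat.prime_of_mem_primesLE (Finset.mem_filter.mp hp).1)).2.2.2
      _ ≤ ∑ n ∈ Finset.Ioc y z, 3 / (n : ℝ) ^ 2 :=
          Finset.sum_le_sum_of_subset_of_nonneg hsub fun n _ _ => by positivity
      _ = 3 * ∑ n ∈ Finset.Ioc y z, ((n : ℝ) ^ 2)⁻¹ := by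
          rw [Finset.mul_sum]; exact Finset.sum_congr rfl fun n _ => by rw [div_eq_mul_inv]
      _ ≤ 3 / y := by
          have h := sum_Ioc_inv_sq_le_sub (α := ℝ) (by omega : y ≠ 0) hyz
          have : 0 ≤ (z : ℝ)⁻¹ := by positivity
          rw [div_eq_mul_inv]
          nlinarith
  rw [hsplit]
  have hP := fiSqProd_pos_le_one y
  have hprod1 : ∏ p ∈ (Nat.primesLE z).filter (fun p => y < p), (1 - fiDensity (p ^ 2)) ≤ 1 :=
    Finset.prod_le_one (fun p hp => (one_sub_fiDensity_sq_pos
        (Nat.prime_of_mem_primesLE (Finset.mem_filter.mp hp).1)).le)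
      fun p hp => (fiSqProd_factor_bounds (Nat.prime_of_mem_primesLE (Finset.mem_filter.mp hp).1)).2.1
  calc fiSqProd y - fiSqProd y * ∏ p ∈ (Nat.primesLE z).filter (fun p => y < p), (1 - fiDensity (p ^ 2))
      = fiSqProd y * (1 - ∏ p ∈ (Nat.primesLE z).filter (fun p => y < p), (1 - fiDensity (p ^ 2))) := by
        ring
    _ ≤ 1 * (1 - ∏ p ∈ (Nat.primesLE z).filter (fun p => y < p), (1 - fiDensity (p ^ 2))) :=
        mul_le_mul_of_nonneg_right hP.2 (by linarith)
    _ ≤ 3 / y := by linarith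

/-- `0 ≤ P(y) - P_∞ ≤ 3/y` (`y ≥ 1`). [folklore] -/
theorem fiSqProd_sub_fiSqConst_le {y : ℕ} (hy : 1 ≤ y) :
    0 ≤ fiSqProd y - fiSqConst ∧ fiSqProd y - fiSqConst ≤ 3 / y := by
  refine ⟨sub_nonneg.mpr (fiSqConst_le_fiSqProd y), ?_⟩
  -- pass to the limit `z → ∞` in `P(y) - P(z) ≤ 3/y`
  have h : ∀ᶠ z : ℕ in atTop, fiSqProd y - 3 / y ≤ fiSqProd z := by
    filter_upwards [eventually_ge_atTop y] with z hz
    linarith [fiSqProd_sub_fiSqProd_le hy hz]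
  have := ge_of_tendsto tendsto_fiSqProd h
  linarith

/-! ### The sieve constant `H' = (4/π) / P_∞` -/

/-- The Euler factor (2.17) of `H'`: `(1 - g'(p))/(1 - 1/p) = [(1 - g(p))/(1 - 1/p)] / (1 - g(p²))`.
[folklore] -/
theorem fiSieveSeqSq_eulerFactor {p : ℕ} (hp : p.Prime) :
    (1 - fiSieveSeqSq.density p) / (1 - (p : ℝ)⁻¹) =
      (1 - fiSieveSeq.density p) / (1 - (p : ℝ)⁻¹) / (1 - fiDensity (p ^ 2)) := by
  change (1 - fiDensitySq p) / _ = (1 - fiDensity p) / _ / _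
  rw [one_sub_fiDensitySq_prime hp]
  have h := (one_sub_fiDensity_sq_pos hp).ne'
  field_simp

/-- The partial Euler products of `H'` are those of `H` divided by `P(y)`. [folklore] -/
theorem fiSieveSeqSq_prod_eulerFactor (y : ℕ) :
    ∏ p ∈ Nat.primesLE y, (1 - fiSieveSeqSq.density p) / (1 - (p : ℝ)⁻¹) =
      (∏ p ∈ Nat.primesLE y, (1 - fiSieveSeq.density p) / (1 - (p : ℝ)⁻¹)) / fiSqProd y := by
  rw [fiSqProd, ← Finset.prod_div_distrib]
  exact Finset.prod_congr rfl fun p hp => fiSieveSeqSq_eulerFactor (Nat.prime_of_mem_primesLE hp)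

/-- **`H' = H / P_∞`**: if `a_n` has sieve constant `H` ((2.17), ordered Euler product), then the
squarefree-supported sequence has sieve constant `H / P_∞`. With (4.8), `H' = (4/π)/P_∞`.
[folklore] -/
theorem hasDensityConstant_fiSieveSeqSq {H : ℝ} (h : fiSieveSeq.HasDensityConstant H) :
    fiSieveSeqSq.HasDensityConstant (H / fiSqConst) := by
  unfold SieveSequence.HasDensityConstant at h ⊢
  simp_rw [fiSieveSeqSq_prod_eulerFactor]
  exact h.div tendsto_fiSqProd fiSqConst_pos.ne'

/-- With (4.8) (`H = 4/π`, the named fact `FriedlanderIwaniec1998_densityConstant`, discharged in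
`FriedlanderIwaniecPrimesProofs`): `H' = (4/π) / P_∞`. [folklore] -/
theorem hasDensityConstant_fiSieveSeqSq_of_densityConstant
    (h48 : FriedlanderIwaniec1998_densityConstant) :
    fiSieveSeqSq.HasDensityConstant (4 / Real.pi / fiSqConst) :=
  hasDensityConstant_fiSieveSeqSq h48

end Literature.NumberTheory.Sieve
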